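import Summits.Parity.GeneralizedHardyLittlewood.Theorems.PrimeLevelFamEdgeMomentsBeyondDiagonalDiagDecorM8Coord
import Summits.Parity.GeneralizedHardyLittlewood.Theorems.PrimeLevelFamEdgeMomentsBeyondDiagonalDiagDecorShiftedBlockDecor
import Summits.Parity.GeneralizedHardyLittlewood.Theorems.PrimeLevelFamEdgeMomentsBeyondDiagonalDiagDecorBilinear
import Summits.Parity.GeneralizedHardyLittlewood.Theorems.PrimeLevelFamEdgeMomentsBeyondDiagonalDiagDecorCollapse
import HarnessLib

/-!
# Route `PrimeLevelFamEdge`, crux K_A `MomentsBeyondDiagonal` (stmt-Parity-20007), line «petersson_layers» v4, stub `stub_diag`: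
# **the `(log g)^t` pieces of the `M₈`-decorated shifted block are `O(log^{t+q+r₁+r₂+4}M)` for EVERY `t ≥ 0`**
# (the `M₈`-twin of `…DiagDecorM4Collapse`; decoration `D = 105P₂⁴ − 420P₂²P₄ + 448P₂P₆ + 140P₄² − 272P₈`, orders `(i,j) = (4,4)` of `stub_diag`)

With the crude coordinate sizes `|T_{M₈}^{[r₁]}(M;n)| ≤ K₁D(n)(1+κ(n))log^{r₁+5}M` (`…DiagDecorM8Coord.abs_shiftedCoordM8_le`) and
`|𝒮^{[r₂]}(M;n)| ≤ K₂D(n)log^{r₂}M/log²M` (`…DiagDecorShiftedCoord.abs_shiftedCoord_le`), word for word the proofs of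
`…DiagDecorM4Collapse` (two logarithms higher):

* `abs_collapseM8_logPow_le` — `t ≥ 1`;  * `abs_collapseM8_zero_le` — `t = 0`.

Remaining for the `M₈` family: the block sum over `t` (`…DiagDecorM4Block` twin) and `L = 2B + ℓ⁺₁ + ℓ⁺₂` (`…DiagDecorM4Family` twin),
giving `|Sel(τM₈/τ·τ·L^m)| ≤ C log^{m+4}M`. Def-free; theorems only. Helper `--supports stmt-Parity-20007`; closes nothing; K_A, K_B
and the Parity summit are NOT proved; nothing about Landau–Siegel zeros.

## References
* E. Kowalski, P. Michel, J. VanderKam, J. reine angew. Math. 526 (2000), (23)–(28) pp. 13–15 and Prop. 5.1 p. 18.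
  [cite: KowalskiMichelVanderKam2000, (23)–(28) — derivation (log g terms of the diagonal weight, eighth divisor-log moment)]
-/

noncomputable section

open scoped Real ArithmeticFunction.Moebius
open Finset ArithmeticFunction Polynomial

namespace Summit.Parity.GeneralizedHardyLittlewood.Theorems.MomentsBeyondDiagonal.DiagKernel

open Literature.NumberTheory.LFunctions Literature.NumberTheory.LFunctions.KMV2000
open MollifierMainTerm (W)
open SelbergCoord (kappa)
open Literature.NumberTheory.Sieve (one_le_log_of_three_le)
open Summit.Parity.GeneralizedHardyLittlewood.Theorems.BeyondDiagonalBeatsQuarter.KernelFormXSq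
  (divWeight divWeight_nonneg abs_W_le totient_mul_W_sq_le sum_kappa_divWeight_sq_div_le sum_divWeight_sq_div_le)

/-- `κ(n) ≥ 0`. [folklore] -/
private theorem kappa_nonneg₈ (n : ℕ) : 0 ≤ kappa n := by
  unfold kappa
  exact Finset.sum_nonneg fun p hp ↦ by
    have hp2 : (2 : ℝ) ≤ p := by exact_mod_cast (Nat.prime_of_mem_primeFactors hp).two_le
    exact div_nonneg (Real.log_nonneg (by linarith)) (by linarith)

/-- **The `(log g)^t` pieces, `t ≥ 1`, of the `M₈`-decorated shifted block are `O(log^{t+q+r₁+r₂+4}M)`.**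
[cite: KowalskiMichelVanderKam2000, (23)–(28) — derivation] -/
theorem abs_collapseM8_logPow_le (P : ℝ[X]) (hP0 : P.coeff 0 = 0) (hP1 : P.coeff 1 = 0) {t : ℕ} (ht : 1 ≤ t)
    (q r₁ r₂ : ℕ) {lam : ℝ} (hlam0 : 0 ≤ lam) (hlam1 : lam ≤ 1) :
    ∃ C : ℝ, 0 < C ∧ ∀ M : ℝ, 3 ≤ M →
      |∑ c ∈ Icc 1 ⌊M⌋₊, ∑ g ∈ Icc 1 (⌊M⌋₊ / c), (μ g : ℝ) * c * Real.log g ^ t * (W (c * g) ^ 2 *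
          ((lam * Real.log M - Real.log (M / ((c * g : ℕ) : ℝ))) ^ q *
            (∑ c' ∈ Finset.range (P.natDegree + 1), P.coeff c' *
              ((∑ k ∈ Icc 1 ⌊M / ((c * g : ℕ) : ℝ)⌋₊, (if k.Coprime (c * g) then W k else 0) *
                ((k.divisors.card : ℝ) *
                  (105 * (∑ p ∈ k.primeFactors, Real.log p ^ 2) ^ 4 -
            420 * (∑ p ∈ k.primeFactors, Real.log p ^ 2) ^ 2 * (∑ p ∈ k.primeFactors, Real.log p ^ 4) +
            448 * (∑ p ∈ k.primeFactors, Real.log p ^ 2) * (∑ p ∈ k.primeFactors, Real.log p ^ 6) +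
            140 * (∑ p ∈ k.primeFactors, Real.log p ^ 4) ^ 2 -
            272 * ∑ p ∈ k.primeFactors, Real.log p ^ 8)) *
                Real.log (M / ((c * g : ℕ) : ℝ) / k) ^ (c' + r₁)) / Real.log M ^ c')) *
            (∑ c' ∈ Finset.range (P.natDegree + 1), P.coeff c' *
              ((∑ k ∈ Icc 1 ⌊M / ((c * g : ℕ) : ℝ)⌋₊, (if k.Coprime (c * g) then W k else 0) * (k.divisors.card : ℝ) *
                Real.log (M / ((c * g : ℕ) : ℝ) / k) ^ (c' + r₂)) / Real.log M ^ c'))))| ≤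
        C * Real.log M ^ (t + q + r₁ + r₂ + 4) := by
  obtain ⟨K₁, hK₁, hb₁⟩ := abs_shiftedCoordM8_le P hP0 hP1 r₁
  obtain ⟨K₂, hK₂, hb₂⟩ := abs_shiftedCoord_le P hP0 hP1 r₂
  set S₁ : ℝ → ℕ → ℝ := fun M n ↦ ∑ c' ∈ Finset.range (P.natDegree + 1), P.coeff c' *
    ((∑ k ∈ Icc 1 ⌊M / n⌋₊, (if k.Coprime n then W k else 0) *
      ((k.divisors.card : ℝ) *
        (105 * (∑ p ∈ k.primeFactors, Real.log p ^ 2) ^ 4 -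
            420 * (∑ p ∈ k.primeFactors, Real.log p ^ 2) ^ 2 * (∑ p ∈ k.primeFactors, Real.log p ^ 4) +
            448 * (∑ p ∈ k.primeFactors, Real.log p ^ 2) * (∑ p ∈ k.primeFactors, Real.log p ^ 6) +
            140 * (∑ p ∈ k.primeFactors, Real.log p ^ 4) ^ 2 -
            272 * ∑ p ∈ k.primeFactors, Real.log p ^ 8)) *
      Real.log (M / n / k) ^ (c' + r₁)) / Real.log M ^ c') with hS₁
  set S₂ : ℝ → ℕ → ℝ := fun M n ↦ ∑ c' ∈ Finset.range (P.natDegree + 1), P.coeff c' *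
    ((∑ k ∈ Icc 1 ⌊M / n⌋₊, (if k.Coprime n then W k else 0) * (k.divisors.card : ℝ) *
      Real.log (M / n / k) ^ (c' + r₂)) / Real.log M ^ c') with hS₂
  set A : ℝ := (∑' d : ℕ, (d : ℝ) ^ (-(5 / 4 : ℝ))) ^ 2 with hA
  have hA0 : 0 ≤ A := by positivity
  refine ⟨K₁ * K₂ * (48 * A * 3) * 2 + 1, by positivity, fun M hM ↦ ?_⟩
  set ℓ := Real.log M with hℓ
  have hℓ1 : 1 ≤ ℓ := one_le_log_of_three_le hM
  have hℓ0 : 0 < ℓ := by linarith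
  have hM0 : 0 < M := by linarith
  set N := ⌊M⌋₊ with hN
  have hN1 : 1 ≤ N := Nat.le_floor (by norm_num; linarith)
  have hlogN : Real.log N ≤ ℓ := Real.log_le_log (by exact_mod_cast hN1) (Nat.floor_le hM0.le)
  have hlogN0 : 0 ≤ Real.log N := Real.log_natCast_nonneg N
  set F : ℕ → ℝ := fun n ↦ (lam * ℓ - Real.log (M / n)) ^ q * S₁ M n * S₂ M n with hF
  have hgoal : |∑ c ∈ Icc 1 N, ∑ g ∈ Icc 1 (N / c), (μ g : ℝ) * c * Real.log g ^ t * (W (c * g) ^ 2 *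
      ((lam * ℓ - Real.log (M / ((c * g : ℕ) : ℝ))) ^ q * S₁ M (c * g) * S₂ M (c * g)))| ≤
      (K₁ * K₂ * (48 * A * 3) * 2 + 1) * ℓ ^ (t + q + r₁ + r₂ + 4) := by
    refine (abs_selbergCollapse_logPow_le ht N F).trans ?_
    have hterm : ∀ n ∈ Icc 1 N, |W n| * kappa n * |F n| ≤
        K₁ * K₂ * (ℓ ^ (q + r₁ + r₂ + 5) / ℓ ^ 2) * (1 + ℓ) * (kappa n * divWeight n ^ 2 / n) := by
      intro n hn
      have hn' := Finset.mem_Icc.1 hn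
      have hn0 : n ≠ 0 := by omega
      have hnM : (n : ℝ) ≤ M := le_trans (by exact_mod_cast hn'.2) (Nat.floor_le hM0.le)
      have hD := divWeight_nonneg n
      have hκ := kappa_nonneg₈ n
      have hW := abs_W_le n
      have hκℓ : kappa n ≤ ℓ := by
        have h1 := kappa_le_log hn0
        have h2 : Real.log n ≤ ℓ := Real.log_le_log (by exact_mod_cast Nat.pos_of_ne_zero hn0) hnM
        linarith
      have hB : |(lam * ℓ - Real.log (M / n)) ^ q| ≤ ℓ ^ q := by
        rw [abs_pow]; exact pow_le_pow_left₀ (abs_nonneg _) (abs_lam_mul_log_sub_log_div_le hlam0 hlam1 hM hn0 hnM) q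
      have hS := mul_le_mul (hb₁ M hM n hn0 hnM) (hb₂ M hM n hn0 hnM) (abs_nonneg _) (by positivity)
      have hF' : |F n| ≤ ℓ ^ q * (K₁ * divWeight n * (1 + kappa n) * ℓ ^ (r₁ + 5) *
          (K₂ * divWeight n * ℓ ^ r₂ / ℓ ^ 2)) := by
        simp only [hF]
        rw [abs_mul, abs_mul, mul_assoc]
        exact mul_le_mul hB hS (by positivity) (by positivity)
      have hn0' : (0 : ℝ) < n := by exact_mod_cast Nat.pos_of_ne_zero hn0
      have h1κ : 1 + kappa n ≤ 1 + ℓ := by linarith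
      calc |W n| * kappa n * |F n|
          ≤ (n : ℝ)⁻¹ * kappa n * (ℓ ^ q * (K₁ * divWeight n * (1 + kappa n) * ℓ ^ (r₁ + 5) *
              (K₂ * divWeight n * ℓ ^ r₂ / ℓ ^ 2))) := by
            gcongr
        _ ≤ (n : ℝ)⁻¹ * kappa n * (ℓ ^ q * (K₁ * divWeight n * (1 + ℓ) * ℓ ^ (r₁ + 5) *
              (K₂ * divWeight n * ℓ ^ r₂ / ℓ ^ 2))) := by
            gcongr
        _ = K₁ * K₂ * (ℓ ^ (q + r₁ + r₂ + 5) / ℓ ^ 2) * (1 + ℓ) * (kappa n * divWeight n ^ 2 / n) := by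
            field_simp
            ring
    have hsum : ∑ n ∈ Icc 1 N, |W n| * kappa n * |F n| ≤
        K₁ * K₂ * (ℓ ^ (q + r₁ + r₂ + 5) / ℓ ^ 2) * (1 + ℓ) * (48 * A * (3 * ℓ)) := by
      calc _ ≤ ∑ n ∈ Icc 1 N, K₁ * K₂ * (ℓ ^ (q + r₁ + r₂ + 5) / ℓ ^ 2) * (1 + ℓ) * (kappa n * divWeight n ^ 2 / n) :=
            Finset.sum_le_sum hterm
        _ = K₁ * K₂ * (ℓ ^ (q + r₁ + r₂ + 5) / ℓ ^ 2) * (1 + ℓ) * ∑ n ∈ Icc 1 N, kappa n * divWeight n ^ 2 / n := by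
            rw [Finset.mul_sum]
        _ ≤ K₁ * K₂ * (ℓ ^ (q + r₁ + r₂ + 5) / ℓ ^ 2) * (1 + ℓ) * (48 * A * (2 + Real.log N)) := by
            refine mul_le_mul_of_nonneg_left ?_ (by positivity)
            have := sum_kappa_divWeight_sq_div_le hN1
            rw [← hA] at this
            exact this
        _ ≤ K₁ * K₂ * (ℓ ^ (q + r₁ + r₂ + 5) / ℓ ^ 2) * (1 + ℓ) * (48 * A * (3 * ℓ)) := by gcongr; linarith
    have hpow : Real.log N ^ (t - 1) ≤ ℓ ^ (t - 1) := pow_le_pow_left₀ hlogN0 hlogN _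
    have hsum0 : 0 ≤ ∑ n ∈ Icc 1 N, |W n| * kappa n * |F n| :=
      Finset.sum_nonneg fun n _ ↦ by have := kappa_nonneg₈ n; positivity
    have h1ℓ : 1 + ℓ ≤ 2 * ℓ := by linarith
    calc Real.log N ^ (t - 1) * ∑ n ∈ Icc 1 N, |W n| * kappa n * |F n|
        ≤ ℓ ^ (t - 1) * (K₁ * K₂ * (ℓ ^ (q + r₁ + r₂ + 5) / ℓ ^ 2) * (1 + ℓ) * (48 * A * (3 * ℓ))) :=
          mul_le_mul hpow hsum hsum0 (by positivity)
      _ ≤ ℓ ^ (t - 1) * (K₁ * K₂ * (ℓ ^ (q + r₁ + r₂ + 5) / ℓ ^ 2) * (2 * ℓ) * (48 * A * (3 * ℓ))) := by gcongr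
      _ = K₁ * K₂ * (48 * A * 3) * 2 * (ℓ ^ (t - 1) * ℓ * ℓ ^ (q + r₁ + r₂ + 5)) * (ℓ * ℓ / ℓ ^ 2) / ℓ := by
          field_simp
      _ = K₁ * K₂ * (48 * A * 3) * 2 * (ℓ ^ t * ℓ ^ (q + r₁ + r₂ + 5)) / ℓ := by
          rw [pow_sub_one_mul (by omega : t ≠ 0) ℓ, show ℓ * ℓ / ℓ ^ 2 = 1 by field_simp, mul_one]
      _ = K₁ * K₂ * (48 * A * 3) * 2 * ℓ ^ (t + q + r₁ + r₂ + 4) := by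
          rw [show t + q + r₁ + r₂ + 4 = t + (q + r₁ + r₂ + 4) by ring, pow_add ℓ t (q + r₁ + r₂ + 4),
            show q + r₁ + r₂ + 5 = (q + r₁ + r₂ + 4) + 1 by ring, pow_succ]
          field_simp
      _ ≤ (K₁ * K₂ * (48 * A * 3) * 2 + 1) * ℓ ^ (t + q + r₁ + r₂ + 4) := by gcongr; linarith
  simpa only [hS₁, hS₂] using hgoal

/-- **The `t = 0` piece of the `M₈`-decorated shifted block is `O(log^{q+r₁+r₂+4}M)`** (`Σ_{g∣n}μ(g)(n/g) = φ(n)`,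
`φ(n)W(n)² ≤ 1/n`). [cite: KowalskiMichelVanderKam2000, (23)–(28) — derivation] -/
theorem abs_collapseM8_zero_le (P : ℝ[X]) (hP0 : P.coeff 0 = 0) (hP1 : P.coeff 1 = 0)
    (q r₁ r₂ : ℕ) {lam : ℝ} (hlam0 : 0 ≤ lam) (hlam1 : lam ≤ 1) :
    ∃ C : ℝ, 0 < C ∧ ∀ M : ℝ, 3 ≤ M →
      |∑ c ∈ Icc 1 ⌊M⌋₊, ∑ g ∈ Icc 1 (⌊M⌋₊ / c), (μ g : ℝ) * c * Real.log g ^ 0 * (W (c * g) ^ 2 *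
          ((lam * Real.log M - Real.log (M / ((c * g : ℕ) : ℝ))) ^ q *
            (∑ c' ∈ Finset.range (P.natDegree + 1), P.coeff c' *
              ((∑ k ∈ Icc 1 ⌊M / ((c * g : ℕ) : ℝ)⌋₊, (if k.Coprime (c * g) then W k else 0) *
                ((k.divisors.card : ℝ) *
                  (105 * (∑ p ∈ k.primeFactors, Real.log p ^ 2) ^ 4 -
            420 * (∑ p ∈ k.primeFactors, Real.log p ^ 2) ^ 2 * (∑ p ∈ k.primeFactors, Real.log p ^ 4) +
            448 * (∑ p ∈ k.primeFactors, Real.log p ^ 2) * (∑ p ∈ k.primeFactors, Real.log p ^ 6) +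
            140 * (∑ p ∈ k.primeFactors, Real.log p ^ 4) ^ 2 -
            272 * ∑ p ∈ k.primeFactors, Real.log p ^ 8)) *
                Real.log (M / ((c * g : ℕ) : ℝ) / k) ^ (c' + r₁)) / Real.log M ^ c')) *
            (∑ c' ∈ Finset.range (P.natDegree + 1), P.coeff c' *
              ((∑ k ∈ Icc 1 ⌊M / ((c * g : ℕ) : ℝ)⌋₊, (if k.Coprime (c * g) then W k else 0) * (k.divisors.card : ℝ) *
                Real.log (M / ((c * g : ℕ) : ℝ) / k) ^ (c' + r₂)) / Real.log M ^ c'))))| ≤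
        C * Real.log M ^ (q + r₁ + r₂ + 4) := by
  obtain ⟨K₁, hK₁, hb₁⟩ := abs_shiftedCoordM8_le P hP0 hP1 r₁
  obtain ⟨K₂, hK₂, hb₂⟩ := abs_shiftedCoord_le P hP0 hP1 r₂
  set S₁ : ℝ → ℕ → ℝ := fun M n ↦ ∑ c' ∈ Finset.range (P.natDegree + 1), P.coeff c' *
    ((∑ k ∈ Icc 1 ⌊M / n⌋₊, (if k.Coprime n then W k else 0) *
      ((k.divisors.card : ℝ) *
        (105 * (∑ p ∈ k.primeFactors, Real.log p ^ 2) ^ 4 -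
            420 * (∑ p ∈ k.primeFactors, Real.log p ^ 2) ^ 2 * (∑ p ∈ k.primeFactors, Real.log p ^ 4) +
            448 * (∑ p ∈ k.primeFactors, Real.log p ^ 2) * (∑ p ∈ k.primeFactors, Real.log p ^ 6) +
            140 * (∑ p ∈ k.primeFactors, Real.log p ^ 4) ^ 2 -
            272 * ∑ p ∈ k.primeFactors, Real.log p ^ 8)) *
      Real.log (M / n / k) ^ (c' + r₁)) / Real.log M ^ c') with hS₁
  set S₂ : ℝ → ℕ → ℝ := fun M n ↦ ∑ c' ∈ Finset.range (P.natDegree + 1), P.coeff c' *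
    ((∑ k ∈ Icc 1 ⌊M / n⌋₊, (if k.Coprime n then W k else 0) * (k.divisors.card : ℝ) *
      Real.log (M / n / k) ^ (c' + r₂)) / Real.log M ^ c') with hS₂
  set A : ℝ := (∑' d : ℕ, (d : ℝ) ^ (-(5 / 4 : ℝ))) ^ 2 with hA
  have hA0 : 0 ≤ A := by positivity
  refine ⟨K₁ * K₂ * (49 * A * 3) + 1, by positivity, fun M hM ↦ ?_⟩
  set ℓ := Real.log M with hℓ
  have hℓ1 : 1 ≤ ℓ := one_le_log_of_three_le hM
  have hℓ0 : 0 < ℓ := by linarith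
  have hM0 : 0 < M := by linarith
  set N := ⌊M⌋₊ with hN
  have hN1 : 1 ≤ N := Nat.le_floor (by norm_num; linarith)
  have hlogN : Real.log N ≤ ℓ := Real.log_le_log (by exact_mod_cast hN1) (Nat.floor_le hM0.le)
  have hlogN0 : 0 ≤ Real.log N := Real.log_natCast_nonneg N
  set F : ℕ → ℝ := fun n ↦ (lam * ℓ - Real.log (M / n)) ^ q * S₁ M n * S₂ M n with hF
  have hgoal : |∑ c ∈ Icc 1 N, ∑ g ∈ Icc 1 (N / c), (μ g : ℝ) * c * Real.log g ^ 0 * (W (c * g) ^ 2 *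
      ((lam * ℓ - Real.log (M / ((c * g : ℕ) : ℝ))) ^ q * S₁ M (c * g) * S₂ M (c * g)))| ≤
      (K₁ * K₂ * (49 * A * 3) + 1) * ℓ ^ (q + r₁ + r₂ + 4) := by
    -- collapse `Σ_cΣ_g μ(g) c W(cg)² F(cg) = Σ_n φ(n) W(n)² F(n)`
    have hcol : ∑ c ∈ Icc 1 N, ∑ g ∈ Icc 1 (N / c), (μ g : ℝ) * c * Real.log g ^ 0 * (W (c * g) ^ 2 *
        ((lam * ℓ - Real.log (M / ((c * g : ℕ) : ℝ))) ^ q * S₁ M (c * g) * S₂ M (c * g))) =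
        ∑ n ∈ Icc 1 N, (Nat.totient n : ℝ) * W n ^ 2 * F n := by
      rw [sum_Icc_sum_Icc_div_eq_sum_sum_divisors N (fun c g ↦ (μ g : ℝ) * c * Real.log g ^ 0 * (W (c * g) ^ 2 *
        ((lam * ℓ - Real.log (M / ((c * g : ℕ) : ℝ))) ^ q * S₁ M (c * g) * S₂ M (c * g))))]
      refine Finset.sum_congr rfl fun n hn ↦ ?_
      have hn0 : n ≠ 0 := by have := (Finset.mem_Icc.1 hn).1; omega
      have hterm : ∀ g ∈ n.divisors, (μ g : ℝ) * ((n / g : ℕ) : ℝ) * Real.log g ^ 0 *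
          (W (n / g * g) ^ 2 * ((lam * ℓ - Real.log (M / ((n / g * g : ℕ) : ℝ))) ^ q * S₁ M (n / g * g) *
            S₂ M (n / g * g))) = (W n ^ 2 * F n) * ((μ g : ℝ) * ((n / g : ℕ) : ℝ)) := by
        intro g hg
        rw [Nat.div_mul_cancel (Nat.dvd_of_mem_divisors hg), pow_zero, mul_one]
        simp only [hF]
        ring
      rw [Finset.sum_congr rfl hterm, ← Finset.mul_sum, sum_divisors_moebius_mul_div_real hn0]
      ring
    rw [hcol]
    have hterm : ∀ n ∈ Icc 1 N, |(Nat.totient n : ℝ) * W n ^ 2 * F n| ≤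
        K₁ * K₂ * (ℓ ^ (q + r₁ + r₂ + 5) / ℓ ^ 2) * ((1 + kappa n) * divWeight n ^ 2 / n) := by
      intro n hn
      have hn' := Finset.mem_Icc.1 hn
      have hn0 : n ≠ 0 := by omega
      have hnM : (n : ℝ) ≤ M := le_trans (by exact_mod_cast hn'.2) (Nat.floor_le hM0.le)
      have hD := divWeight_nonneg n
      have hκ := kappa_nonneg₈ n
      have hφ := totient_mul_W_sq_le n
      have hφ0 : 0 ≤ (Nat.totient n : ℝ) * W n ^ 2 := by positivity
      have hB : |(lam * ℓ - Real.log (M / n)) ^ q| ≤ ℓ ^ q := by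
        rw [abs_pow]; exact pow_le_pow_left₀ (abs_nonneg _) (abs_lam_mul_log_sub_log_div_le hlam0 hlam1 hM hn0 hnM) q
      have hS := mul_le_mul (hb₁ M hM n hn0 hnM) (hb₂ M hM n hn0 hnM) (abs_nonneg _) (by positivity)
      have hF' : |F n| ≤ ℓ ^ q * (K₁ * divWeight n * (1 + kappa n) * ℓ ^ (r₁ + 5) *
          (K₂ * divWeight n * ℓ ^ r₂ / ℓ ^ 2)) := by
        simp only [hF]
        rw [abs_mul, abs_mul, mul_assoc]
        exact mul_le_mul hB hS (by positivity) (by positivity)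
      have hn0' : (0 : ℝ) < n := by exact_mod_cast Nat.pos_of_ne_zero hn0
      rw [abs_mul, abs_of_nonneg hφ0]
      calc (Nat.totient n : ℝ) * W n ^ 2 * |F n|
          ≤ (n : ℝ)⁻¹ * (ℓ ^ q * (K₁ * divWeight n * (1 + kappa n) * ℓ ^ (r₁ + 5) *
              (K₂ * divWeight n * ℓ ^ r₂ / ℓ ^ 2))) := mul_le_mul hφ hF' (abs_nonneg _) (by positivity)
        _ = K₁ * K₂ * (ℓ ^ (q + r₁ + r₂ + 5) / ℓ ^ 2) * ((1 + kappa n) * divWeight n ^ 2 / n) := by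
            field_simp
            ring
    have hsum : ∑ n ∈ Icc 1 N, |(Nat.totient n : ℝ) * W n ^ 2 * F n| ≤
        K₁ * K₂ * (ℓ ^ (q + r₁ + r₂ + 5) / ℓ ^ 2) * (49 * A * (3 * ℓ)) := by
      calc _ ≤ ∑ n ∈ Icc 1 N, K₁ * K₂ * (ℓ ^ (q + r₁ + r₂ + 5) / ℓ ^ 2) * ((1 + kappa n) * divWeight n ^ 2 / n) :=
            Finset.sum_le_sum hterm
        _ = K₁ * K₂ * (ℓ ^ (q + r₁ + r₂ + 5) / ℓ ^ 2) *
              (∑ n ∈ Icc 1 N, divWeight n ^ 2 / n + ∑ n ∈ Icc 1 N, kappa n * divWeight n ^ 2 / n) := by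
            rw [← Finset.sum_add_distrib, Finset.mul_sum]
            exact Finset.sum_congr rfl fun n _ ↦ by ring
        _ ≤ K₁ * K₂ * (ℓ ^ (q + r₁ + r₂ + 5) / ℓ ^ 2) * (A * (2 + Real.log N) + 48 * A * (2 + Real.log N)) := by
            refine mul_le_mul_of_nonneg_left (add_le_add ?_ ?_) (by positivity)
            · have := sum_divWeight_sq_div_le hN1
              rw [← hA] at this
              exact this
            · have := sum_kappa_divWeight_sq_div_le hN1
              rw [← hA] at this
              exact this
        _ = K₁ * K₂ * (ℓ ^ (q + r₁ + r₂ + 5) / ℓ ^ 2) * (49 * A * (2 + Real.log N)) := by ring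
        _ ≤ K₁ * K₂ * (ℓ ^ (q + r₁ + r₂ + 5) / ℓ ^ 2) * (49 * A * (3 * ℓ)) := by gcongr; linarith
    calc _ ≤ ∑ n ∈ Icc 1 N, |(Nat.totient n : ℝ) * W n ^ 2 * F n| := Finset.abs_sum_le_sum_abs _ _
      _ ≤ K₁ * K₂ * (ℓ ^ (q + r₁ + r₂ + 5) / ℓ ^ 2) * (49 * A * (3 * ℓ)) := hsum
      _ = K₁ * K₂ * (49 * A * 3) * ℓ ^ (q + r₁ + r₂ + 4) * (ℓ * ℓ / ℓ ^ 2) := by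
          rw [show q + r₁ + r₂ + 5 = (q + r₁ + r₂ + 4) + 1 by ring, pow_succ]; ring
      _ = K₁ * K₂ * (49 * A * 3) * ℓ ^ (q + r₁ + r₂ + 4) := by
          rw [show ℓ * ℓ / ℓ ^ 2 = 1 by field_simp, mul_one]
      _ ≤ (K₁ * K₂ * (49 * A * 3) + 1) * ℓ ^ (q + r₁ + r₂ + 4) := by gcongr; linarith
  simpa only [hS₁, hS₂] using hgoal

end Summit.Parity.GeneralizedHardyLittlewood.Theorems.MomentsBeyondDiagonal.DiagKernel

end
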